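import Summits.NavierStokesRegularity.NavierStokesRegularity.Theorems.ScenarioCensusRowF1ColumnarZoom
import HarnessLib

/-!
# LINE «columnar-top» port, part 3/4: the slack transfer and its two rigidity consequences

Re-homed for the scenario census (typer seat ns-census-typer-1 g7; the cells F1sd ⊆ F1co and F1sv ⊆ F1vs ⊆ F1va are MEMBERS OF RECORD «DECIDED IN
KERNEL IN FILES» of row F1 since census v1.68 (critic idea-crit-3 PASS 19:19:37Z; ref ns-census-ref g8 PRE-CHECK ✓ §13.14 [2/6]; lit §21.20); this port makes
them TREE-decided): VERBATIM PORT of ns-idea-3 LINE 15 «columnar-top», `pub/ideators/ns-idea-3/lines/columnar-top/line-columnar-top.lean` sha16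
c9a7d5b1dc6ba717 (818 l., lean check rc 0, 0 sorry), split for the 400-line rule into `ScenarioCensusRowF1Columnar` (§1) → `…ColumnarZoom` (§2) →
`…ColumnarTransfer` (§3) → `…ColumnarTop` (§4 + census KEYS).  Lean text VERBATIM in namespace `…Theorems.ScenarioCensus.ColumnarTop` (the line's
`…Cruxes.ScenarioCensusRowF1.ColumnarTopLine` re-homed); port edits: `@[conjecture]` on the residual `ColumnarCollapse` (≡ `ScenarioCensus.Row_F1`, OPEN),
three one-line docstrings added.

No census VALUE is moved here (row F1 stays OPEN-WITH-LINE; the members become TREE-decided by name); NS regularity is NOT proved; `Row_F1` is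
untouched (zero movement, `columnarCollapse_iff_rowF1`); no summit statement is proved by this file.
-/

-- the summit and its single problem share the name `NavierStokesRegularity` (D-0017 nested layout)
set_option linter.dupNamespace false

noncomputable section

open MeasureTheory Set Function Filter TopologicalSpace Metric
open scoped Topology NNReal ENNReal InnerProductSpace RealInnerProductSpace

namespace Summit.NavierStokesRegularity.NavierStokesRegularity.Theorems.ScenarioCensus.ColumnarTop

open Literature.Analysis Literature.Analysis.FluidPDE
open Summit.NavierStokesRegularity.NavierStokesRegularity.Theorems

/-! ## §3 The slack transfer and its two rigidity consequences -/

/-- The physical times `τ_j = T + c_j² β t ↑ T` of the zoom at rescaled time `t < 0`. -/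
theorem tendsto_physicalTime {T β t : ℝ} (hβ : 0 < β) (ht : t < 0) {c : ℕ → ℝ} (hcpos : ∀ j, 0 < c j)
    (hclim : Tendsto c atTop (𝓝 0)) : Tendsto (fun j => T + c j ^ 2 * β * t) atTop (𝓝[<] T) := by
  have hτlim : Tendsto (fun j => T + c j ^ 2 * β * t) atTop (𝓝 T) := by
    have h : Tendsto (fun j => T + c j ^ 2 * β * t) atTop (𝓝 (T + 0 ^ 2 * β * t)) :=
      (((hclim.pow 2).mul_const β).mul_const t).const_add T
    rw [zero_pow two_ne_zero, zero_mul, zero_mul, add_zero] at h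
    exact h
  have hτT : ∀ j : ℕ, T + c j ^ 2 * β * t < T := by
    intro j
    have : 0 < c j ^ 2 * β := mul_pos (pow_pos (hcpos j) 2) hβ
    nlinarith
  exact tendsto_nhdsWithin_iff.2 ⟨hτlim, Eventually.of_forall hτT⟩

/-- **Top bookkeeping**: a point `y` with `W(t, y) ≠ 0` comes from `Λ(τ_j)`-fast points `x₀ + c_j R y` at the
physical times `τ_j`, eventually in `j` (the level is subcritical: `c_j Λ(τ_j) → 0` while
`c_j α ‖u(τ_j, x_j)‖ → ‖W(t, y)‖ > 0`). -/
theorem eventually_fast {T : ℝ} {u : ℝ → E3 → E3} {x₀ : E3} {α β R : ℝ} {c : ℕ → ℝ} {W : ℝ → E3 → E3}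
    (hα : 0 < α) (hβ : 0 < β) (hcpos : ∀ j, 0 < c j) (hclim : Tendsto c atTop (𝓝 0))
    (hpt : ∀ t < 0, ∀ y : E3,
      Tendsto (fun j => (c j * α) • u (T + c j ^ 2 * β * t) (x₀ + (c j * R) • y)) atTop (𝓝 (W t y)))
    {Λ : ℝ → ℝ} (hΛ : IsSubcriticalLevel T Λ) {t : ℝ} (ht : t < 0) {y : E3} (hne : W t y ≠ 0) :
    ∀ᶠ j in atTop, Λ (T + c j ^ 2 * β * t) < ‖u (T + c j ^ 2 * β * t) (x₀ + (c j * R) • y)‖ := by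
  have ht' : 0 < -t := neg_pos.2 ht
  have hsqrtτ : ∀ j : ℕ, Real.sqrt (T - (T + c j ^ 2 * β * t)) = c j * Real.sqrt (β * (-t)) := by
    intro j
    have e : T - (T + c j ^ 2 * β * t) = c j ^ 2 * (β * (-t)) := by ring
    rw [e, Real.sqrt_mul (sq_nonneg _), Real.sqrt_sq (hcpos _).le]
  have hpos : 0 < ‖W t y‖ := norm_pos_iff.2 hne
  have hβt : 0 < Real.sqrt (β * (-t)) := Real.sqrt_pos.2 (by positivity)
  have f1 : ∀ᶠ j in atTop, ‖W t y‖ / 2 < ‖(c j * α) • u (T + c j ^ 2 * β * t) (x₀ + (c j * R) • y)‖ :=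
    ((hpt t ht y).norm).eventually_const_lt (by linarith)
  have hg : Tendsto (fun j => Λ (T + c j ^ 2 * β * t) * (c j * α)) atTop (𝓝 0) := by
    have h := (hΛ.comp (tendsto_physicalTime hβ ht hcpos hclim)).mul_const (α / Real.sqrt (β * (-t)))
    rw [zero_mul] at h
    refine h.congr fun j => ?_
    show Λ (T + c j ^ 2 * β * t) * Real.sqrt (T - (T + c j ^ 2 * β * t)) *
        (α / Real.sqrt (β * (-t))) = Λ (T + c j ^ 2 * β * t) * (c j * α)
    rw [hsqrtτ j]
    have hs' : Real.sqrt (β * (-t)) ≠ 0 := hβt.ne'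
    calc Λ (T + c j ^ 2 * β * t) * (c j * Real.sqrt (β * (-t))) * (α / Real.sqrt (β * (-t)))
        = Λ (T + c j ^ 2 * β * t) * (c j * α) *
            (Real.sqrt (β * (-t)) / Real.sqrt (β * (-t))) := by ring
      _ = Λ (T + c j ^ 2 * β * t) * (c j * α) := by rw [div_self hs', mul_one]
  have f2 : ∀ᶠ j in atTop, Λ (T + c j ^ 2 * β * t) * (c j * α) < ‖W t y‖ / 2 :=
    hg.eventually_lt_const (by linarith)
  filter_upwards [f1, f2] with j hj1 hj2
  have hcαj : 0 < c j * α := mul_pos (hcpos _) hα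
  rw [norm_smul, Real.norm_eq_abs, abs_of_pos hcαj] at hj1
  have hlt : Λ (T + c j ^ 2 * β * t) * (c j * α) <
      ‖u (T + c j ^ 2 * β * t) (x₀ + (c j * R) • y)‖ * (c j * α) := by
    rw [mul_comm (‖u _ _‖)]
    linarith
  exact lt_of_mul_lt_mul_right hlt hcαj.le

/-- **SLACK TRANSFER** (the new step, one lemma for the three rows).  Let `Q` be a continuous read-out of
the velocity gradient, homogeneous under real scalars (`Q(a L) = a Q(L)`: a directional derivative
`L ↦ L e`, the vorticity `curlCLM`, its component orthogonal to `e`, …).  If on the top of `u` at a subcritical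
level `(T − t') ‖Q(∇u(t', x))‖ ≤ ε` eventually, for every `ε > 0`, and the zooms converge with their gradients
to `W`, then `Q(∇W(t, y)) = 0` at every `y` with `W(t, y) ≠ 0`: indeed `Q` of the zoom gradient at `(t, y)` is
`c_j² α R · Q(∇u(τ_j, x_j))` with `T − τ_j = c_j² β |t|`, so its norm is `≤ (α R / (β |t|)) ε`, and `c_j`
has cancelled. -/
theorem slack_transfer {T : ℝ} {u : ℝ → E3 → E3} {x₀ : E3} {α β R : ℝ} {c : ℕ → ℝ} {W : ℝ → E3 → E3}
    (hα : 0 < α) (hβ : 0 < β) (hR : 0 < R) (hcpos : ∀ j, 0 < c j) (hclim : Tendsto c atTop (𝓝 0))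
    (hpt : ∀ t < 0, ∀ y : E3,
      Tendsto (fun j => (c j * α) • u (T + c j ^ 2 * β * t) (x₀ + (c j * R) • y)) atTop (𝓝 (W t y)))
    (hgrad : ∀ t < 0, ∀ y : E3,
      Tendsto (fun j => (c j * α * (c j * R)) • fderiv ℝ (u (T + c j ^ 2 * β * t)) (x₀ + (c j * R) • y))
        atTop (𝓝 (fderiv ℝ (W t) y)))
    {Q : (E3 →L[ℝ] E3) → E3} (hQc : Continuous Q) (hQs : ∀ (a : ℝ) (L : E3 →L[ℝ] E3), Q (a • L) = a • Q L)
    {Λ : ℝ → ℝ} (hΛ : IsSubcriticalLevel T Λ)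
    (hslack : ∀ ε : ℝ, 0 < ε → ∀ᶠ t' in 𝓝[<] T, ∀ x : E3, Λ t' < ‖u t' x‖ →
      (T - t') * ‖Q (fderiv ℝ (u t') x)‖ ≤ ε) :
    ∀ t < 0, ∀ y, W t y ≠ 0 → Q (fderiv ℝ (W t) y) = 0 := by
  intro t ht y hne
  have ht' : 0 < -t := neg_pos.2 ht
  set K : ℝ := α * R / (β * (-t)) with hK
  have hK0 : 0 < K := by positivity
  -- the limit of the read-outs of the zoom gradients
  have hlim : Tendsto (fun j => ‖Q ((c j * α * (c j * R)) •
      fderiv ℝ (u (T + c j ^ 2 * β * t)) (x₀ + (c j * R) • y))‖) atTop (𝓝 ‖Q (fderiv ℝ (W t) y)‖) :=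
    ((hQc.tendsto _).comp (hgrad t ht y)).norm
  have hfast := eventually_fast hα hβ hcpos hclim hpt hΛ ht hne
  have hτ := tendsto_physicalTime (T := T) hβ ht hcpos hclim
  -- `‖Q(∇W(t,y))‖ ≤ ε'` for every `ε' > 0`
  have hle : ∀ ε' : ℝ, 0 < ε' → ‖Q (fderiv ℝ (W t) y)‖ ≤ ε' := by
    intro ε' hε'
    have hεK : 0 < ε' / K := div_pos hε' hK0
    refine le_of_tendsto hlim ?_
    filter_upwards [hfast, hτ.eventually (hslack (ε' / K) hεK)] with j hj1 hj2
    have hb := hj2 _ hj1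
    have eT : T - (T + c j ^ 2 * β * t) = c j ^ 2 * β * (-t) := by ring
    rw [eT] at hb
    have hcj : 0 < c j := hcpos j
    rw [hQs, norm_smul, Real.norm_eq_abs, abs_of_pos (by positivity : 0 < c j * α * (c j * R))]
    have hβt : β * (-t) ≠ 0 := (mul_pos hβ ht').ne'
    have e2 : c j * α * (c j * R) * ‖Q (fderiv ℝ (u (T + c j ^ 2 * β * t)) (x₀ + (c j * R) • y))‖ =
        K * (c j ^ 2 * β * (-t) * ‖Q (fderiv ℝ (u (T + c j ^ 2 * β * t)) (x₀ + (c j * R) • y))‖) := by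
      calc c j * α * (c j * R) * ‖Q (fderiv ℝ (u (T + c j ^ 2 * β * t)) (x₀ + (c j * R) • y))‖
          = α * R * (c j ^ 2 * ‖Q (fderiv ℝ (u (T + c j ^ 2 * β * t)) (x₀ + (c j * R) • y))‖) := by ring
        _ = α * R / (β * (-t)) * (β * (-t)) *
              (c j ^ 2 * ‖Q (fderiv ℝ (u (T + c j ^ 2 * β * t)) (x₀ + (c j * R) • y))‖) := by
            rw [div_mul_cancel₀ _ hβt]
        _ = K * (c j ^ 2 * β * (-t) * ‖Q (fderiv ℝ (u (T + c j ^ 2 * β * t)) (x₀ + (c j * R) • y))‖) := by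
            rw [hK]; ring
    rw [e2]
    calc K * (c j ^ 2 * β * (-t) * ‖Q (fderiv ℝ (u (T + c j ^ 2 * β * t)) (x₀ + (c j * R) • y))‖)
        ≤ K * (ε' / K) := mul_le_mul_of_nonneg_left hb hK0.le
      _ = ε' := by field_simp
  have h0 : ‖Q (fderiv ℝ (W t) y)‖ ≤ 0 :=
    le_of_forall_pos_le_add fun ε' hε' => by rw [zero_add]; exact hle ε' hε'
  exact norm_eq_zero.1 (le_antisymm h0 (norm_nonneg _))

/-- The nonzero set of a slice of `𝒦_C` is open. -/
theorem isOpen_ne_zero {C : ℝ} {W : ℝ → E3 → E3} (hW : IsTypeIAncientMild C W) {t : ℝ} (ht : t < 0) :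
    IsOpen {y : E3 | W t y ≠ 0} :=
  isOpen_compl_singleton.preimage (hW.continuous_slice ht)

/-- **Analytic globalisation**: an analytic read-out vanishing where a NONTRIVIAL slice of `𝒦_C` is nonzero
vanishes everywhere (identity theorem on the open nonzero set). -/
theorem eq_zero_of_eq_zero_on_ne_zero {C : ℝ} {W : ℝ → E3 → E3} (hW : IsTypeIAncientMild C W) {t : ℝ}
    (ht : t < 0) {F : Type*} [NormedAddCommGroup F] [NormedSpace ℝ F] {g : E3 → F}
    (hg : AnalyticOnNhd ℝ g univ) (h : ∀ y, W t y ≠ 0 → g y = 0) {z : E3} (hz : W t z ≠ 0) :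
    ∀ y, g y = 0 := by
  have hev : g =ᶠ[𝓝 z] 0 :=
    eventually_of_mem ((isOpen_ne_zero hW ht).mem_nhds hz) fun y hy => h y hy
  have key := hg.eqOn_zero_of_preconnected_of_eventuallyEq_zero isPreconnected_univ (mem_univ z) hev
  exact fun y => key (mem_univ y)

/-- **Rigidity 1 (columnar)**: if `∂_e W(t, ·) = 0` wherever `W(t, ·) ≠ 0`, then the slice `W(t, ·)` is
invariant under translations along `e` (identity theorem for the analytic function `∂_e W(t,·)`, then
constancy along the lines `y + ℝ e`). -/
theorem lineInvariant_slice_of_fderiv_apply_eq_zero {C : ℝ} {W : ℝ → E3 → E3} (hW : IsTypeIAncientMild C W)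
    {t : ℝ} (ht : t < 0) {e : E3} (h : ∀ y, W t y ≠ 0 → fderiv ℝ (W t) y e = 0) :
    ∀ y (r : ℝ), W t (y + r • e) = W t y := by
  by_cases hS : ∃ z, W t z ≠ 0
  · obtain ⟨z, hz⟩ := hS
    have hga : AnalyticOnNhd ℝ (fun y => fderiv ℝ (W t) y e) univ :=
      (ContinuousLinearMap.apply ℝ E3 e).comp_analyticOnNhd (hW.analyticOnNhd_slice_univ ht).fderiv
    have hall : ∀ y, fderiv ℝ (W t) y e = 0 := eq_zero_of_eq_zero_on_ne_zero hW ht hga h hz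
    have hdiff : Differentiable ℝ (W t) :=
      (hW.contDiff_slice ht).differentiable (by simp)
    intro y r
    have hg : ∀ s : ℝ, HasDerivAt (fun s : ℝ => W t (y + s • e)) (fderiv ℝ (W t) (y + s • e) e) s := by
      intro s
      have h1 : HasDerivAt (fun s : ℝ => y + s • e) e s := by
        simpa using ((hasDerivAt_id s).smul_const e).const_add y
      exact (hdiff (y + s • e)).hasFDerivAt.comp_hasDerivAt s h1
    have hconst := is_const_of_deriv_eq_zero (f := fun s : ℝ => W t (y + s • e))
      (fun s => (hg s).differentiableAt) (fun s => by rw [(hg s).deriv, hall]) r 0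
    simpa using hconst
  · push Not at hS
    intro y r
    rw [hS, hS]

/-- **Rigidity 2 (vorticity axis)**: if `curl W(t, ·)` is parallel to `e ≠ 0` wherever `W(t, ·) ≠ 0`, then
the slice `W(t, ·)` is invariant under translations along `e` (`curl_parallel_of_parallel_on_open`:
analyticity globalises the alignment; `translationInvariant_of_curl_parallel`: bounded div-free Liouville). -/
theorem lineInvariant_slice_of_curl_parallel {C : ℝ} {W : ℝ → E3 → E3} (hW : IsTypeIAncientMild C W)
    {t : ℝ} (ht : t < 0) {e : E3} (he : e ≠ 0)
    (h : ∀ y, W t y ≠ 0 → ∃ a : ℝ, curl (W t) y = a • e) :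
    ∀ y (r : ℝ), W t (y + r • e) = W t y := by
  have hpar : ∀ y, ∃ a : ℝ, curl (W t) y = a • e := by
    by_cases hS : ∃ z, W t z ≠ 0
    · obtain ⟨z, hz⟩ := hS
      exact curl_parallel_of_parallel_on_open (hW.analyticOnNhd_slice_univ ht) (isOpen_ne_zero hW ht)
        ⟨z, hz⟩ fun y hy => h y hy
    · push Not at hS
      have h0 : W t = fun _ => (0 : E3) := funext hS
      intro y
      refine ⟨0, ?_⟩
      rw [zero_smul, h0, curl_eq_curlCLM, fderiv_const_apply, map_zero]
  exact fun y r => translationInvariant_of_curl_parallel ((hW.contDiff_slice ht).of_le (by norm_cast))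
    (hW.isDivFree ht) ⟨C / Real.sqrt (-t), fun x => hW.norm_le ht x⟩ he hpar y r

/-- **Columnar transfer ⇒ vanishing**: under the zoom package, a slack direction on the top at a subcritical
level forces `W ≡ 0` on the open past. -/
theorem eq_zero_of_slackDirection {T : ℝ} {u : ℝ → E3 → E3} {x₀ : E3} {C α β R : ℝ} {c : ℕ → ℝ}
    {W : ℝ → E3 → E3} (hα : 0 < α) (hβ : 0 < β) (hR : 0 < R) (hcpos : ∀ j, 0 < c j)
    (hclim : Tendsto c atTop (𝓝 0)) (hW : IsTypeIAncientMild C W)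
    (hpt : ∀ t < 0, ∀ y : E3,
      Tendsto (fun j => (c j * α) • u (T + c j ^ 2 * β * t) (x₀ + (c j * R) • y)) atTop (𝓝 (W t y)))
    (hgrad : ∀ t < 0, ∀ y : E3,
      Tendsto (fun j => (c j * α * (c j * R)) • fderiv ℝ (u (T + c j ^ 2 * β * t)) (x₀ + (c j * R) • y))
        atTop (𝓝 (fderiv ℝ (W t) y)))
    {Λ : ℝ → ℝ} (hΛ : IsSubcriticalLevel T Λ) {e : E3} (he : ‖e‖ = 1) (hsl : HasSlackDirectionAt T Λ e u) :
    ∀ t < 0, ∀ x, W t x = 0 := by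
  have he0 : e ≠ 0 := by
    intro h0; rw [h0, norm_zero] at he; exact zero_ne_one he
  have hQ := slack_transfer hα hβ hR hcpos hclim hpt hgrad (Q := fun L : E3 →L[ℝ] E3 => L e)
    (continuous_eval_const e) (fun a L => rfl) hΛ hsl
  exact eq_zero_of_lineInvariant hW he0 fun t ht =>
    lineInvariant_slice_of_fderiv_apply_eq_zero hW ht fun y hy => hQ t ht y hy

/-- The read-out «component of the vorticity orthogonal to `e`» of the gradient. -/
def axialDefect (e : E3) (L : E3 →L[ℝ] E3) : E3 := curlCLM L - ⟪curlCLM L, e⟫_ℝ • e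

/-- The axial defect of `Dv(x)` is `curl v x` minus its `e`-component. -/
theorem axialDefect_fderiv (e : E3) (v : E3 → E3) (x : E3) :
    axialDefect e (fderiv ℝ v x) = curl v x - ⟪curl v x, e⟫_ℝ • e := by
  rw [axialDefect, ← curl_eq_curlCLM]

/-- The axial defect is continuous in the gradient. -/
theorem continuous_axialDefect (e : E3) : Continuous (axialDefect e) := by
  have h1 : Continuous fun L : E3 →L[ℝ] E3 => curlCLM L := curlCLM.continuous
  have h2 : Continuous fun L : E3 →L[ℝ] E3 => ⟪curlCLM L, e⟫_ℝ := h1.inner continuous_const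
  have h3 : Continuous fun L : E3 →L[ℝ] E3 => ⟪curlCLM L, e⟫_ℝ • e := h2.smul continuous_const
  exact h1.sub h3

/-- The axial defect is homogeneous. -/
theorem axialDefect_smul (e : E3) (a : ℝ) (L : E3 →L[ℝ] E3) :
    axialDefect e (a • L) = a • axialDefect e L := by
  simp only [axialDefect, map_smul, real_inner_smul_left, smul_sub, smul_smul]

/-- **Vorticity-axis transfer ⇒ vanishing**: under the zoom package, a vorticity axis on the top at a
subcritical level forces `W ≡ 0` on the open past. -/
theorem eq_zero_of_vorticityAxis {T : ℝ} {u : ℝ → E3 → E3} {x₀ : E3} {C α β R : ℝ} {c : ℕ → ℝ}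
    {W : ℝ → E3 → E3} (hα : 0 < α) (hβ : 0 < β) (hR : 0 < R) (hcpos : ∀ j, 0 < c j)
    (hclim : Tendsto c atTop (𝓝 0)) (hW : IsTypeIAncientMild C W)
    (hpt : ∀ t < 0, ∀ y : E3,
      Tendsto (fun j => (c j * α) • u (T + c j ^ 2 * β * t) (x₀ + (c j * R) • y)) atTop (𝓝 (W t y)))
    (hgrad : ∀ t < 0, ∀ y : E3,
      Tendsto (fun j => (c j * α * (c j * R)) • fderiv ℝ (u (T + c j ^ 2 * β * t)) (x₀ + (c j * R) • y))
        atTop (𝓝 (fderiv ℝ (W t) y)))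
    {Λ : ℝ → ℝ} (hΛ : IsSubcriticalLevel T Λ) {e : E3} (he : ‖e‖ = 1) (hax : HasVorticityAxisAt T Λ e u) :
    ∀ t < 0, ∀ x, W t x = 0 := by
  have he0 : e ≠ 0 := by
    intro h0; rw [h0, norm_zero] at he; exact zero_ne_one he
  have hslack : ∀ ε : ℝ, 0 < ε → ∀ᶠ t' in 𝓝[<] T, ∀ x : E3, Λ t' < ‖u t' x‖ →
      (T - t') * ‖axialDefect e (fderiv ℝ (u t') x)‖ ≤ ε := by
    intro ε hε
    filter_upwards [hax ε hε] with t' ht' x hx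
    rw [axialDefect_fderiv]
    exact ht' x hx
  have hQ := slack_transfer hα hβ hR hcpos hclim hpt hgrad (continuous_axialDefect e) (axialDefect_smul e)
    hΛ hslack
  refine eq_zero_of_lineInvariant hW he0 fun t ht => lineInvariant_slice_of_curl_parallel hW ht he0 ?_
  intro y hy
  have h1 := hQ t ht y hy
  rw [axialDefect_fderiv, sub_eq_zero] at h1
  exact ⟨_, h1⟩

end Summit.NavierStokesRegularity.NavierStokesRegularity.Theorems.ScenarioCensus.ColumnarTop

end
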